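import Summits.CriticalPhenomena.PercolationContinuityZ3.Theorems.PercAnnulusCrossingIICPointHarris
import Summits.CriticalPhenomena.PercolationContinuityZ3.Theorems.PercAnnulusCrossingIICRerootedPair
import HarnessLib

/-!
# The k-point function of Kesten's IIC is at least `c^k ∏ π(edge lengths)` for EVERY spanning tree — no separation (lane RSW3, p1 gen 22)

builds on p205010 (kernel theorem, internal audit signed; external expert review pending) — USED through `θ(p_c) = 0` (exact re-rooting
of a finite configuration).

RSW3 lane (LANE 3 `prim-rsw3`), seat `prim-rsw3-p1` (gen 22).  Helper file (`--supports stmt-CriticalPhenomena-4575`); no definitions,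
no sorries.  Memo `run/shared/lean/prim/rsw3/P1-QM.md` §35.

Gen 21 (`…IICManyPointsTreeLower`) proved `c^k ∏_{i} π(‖z_i − z_{p(i)}‖) ≤ ν(z_1, …, z_k ∈ C(0))` for sites inserted along a
`(2l²+l)`-SEPARATED dendrogram, under (A2)□ + `CU⁺_l` + UAD.  With the quasi-Harris inequality of `…IICPointHarris` (a new site joins
the IIC at the one-arm price WHATEVER else the IIC contains) the same top-down induction — attach `z_i` to its parent `z_{p(i)}` after
re-rooting the IIC exactly at the parent — needs NO separation and NO annulus decay:

* `iicMeasure_real_openConn_inter_biInter_finset_eq_reroot` — re-rooting a finite configuration of sites (`Finset` form):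
  `ν({0 ↔ v} ∩ ⋂_{z∈S}{0 ↔ z}) = ν({0 ↔ −v} ∩ ⋂_{z∈S}{0 ↔ z − v})` (`θ(p) = 0`, (A2)□);
* **`exists_iicMeasure_real_biInter_openConn_ge_pow_mul_prod_tree_criticalProbI`** — at `p_c(ℤ^d)`, `d ≥ 2`, under (A2)□(s,L) + `CU⁺_l`:
  there is `c > 0` such that for every IIC probability measure `ν`, every `k`, all sites `z_0 = 0, z_1, …, z_k` and EVERY parent function
  `p(i) < i` with `z_i ≠ z_{p(i)}`: **`c^k · ∏_{i=1}^{k} π_{p_c}(‖z_i − z_{p(i)}‖_∞) ≤ ν(⋂_{i=1}^{k}{0 ↔ z_i})`** — FOR EVERY SPANNING TREE `T` OF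
  `{0, z_1, …, z_k}`: `ν(z_1, …, z_k ∈ C(0)) ≥ c^k ∏_{e ∈ T} π(|e|)`.  Since `π` is non-increasing, the best tree is the minimal spanning tree:
  **`ν(S ⊆ C(0)) ≥ c^{|S|} ∏_{e ∈ MST({0} ∪ S)} π_{p_c}(|e|)` for EVERY finite configuration `S`** — the lower half of the tree formula for
  the `k`-point function of the IIC with no separation hypothesis (the upper half: `…IICSpanningTreeUpper`).
References: H. Kesten, PTRF 73 (1986) Thm. (3), (8); D. Basu, A. Sapozhnikov, ECP 22 (2017) Thm. 1.1, Remark 2.1.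
-/

noncomputable section

namespace Summit.CriticalPhenomena.PercolationContinuityZ3.Theorems.Crossing

open MeasureTheory Filter Topology Literature.Probability.Percolation Literature.Probability.LatticeModels
open Literature.Probability.Percolation.DCT16
open Summit.CriticalPhenomena.PercolationContinuityZ3.Theorems.SurfaceTension

variable {d : ℕ}

/-! ## §1 Re-rooting a finite configuration of sites -/

/-- **RE-ROOTING A FINITE CONFIGURATION OF SITES** (`θ(p) = 0`, (A2)□ at aspect `(s,L)`, `2 ≤ s`, `0 < p`, `d ≥ 1`): for every IIC probability
measure `ν`, every site `v` and every finite set of sites `S`: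
**`ν({0 ↔ v} ∩ ⋂_{z∈S}{0 ↔ z}) = ν({0 ↔ −v} ∩ ⋂_{z∈S}{0 ↔ z − v})`** — the configuration `{v} ∪ S` seen from `0` is the configuration
`{−v} ∪ (S − v)` seen from `v` (gen 10's exact re-rooting with `E = ⋂_{z∈S}{0 ↔ z}`, whose shift is `⋂_{z∈S}{−v ↔ z − v}`, and transitivity
through `0 ↔ −v`). [cite: BasuSapozhnikov2017ECP, Thm. 1.1 and Remark 2.1] [cite: Kesten1986, Thm. (3)] -/
theorem iicMeasure_real_openConn_inter_biInter_finset_eq_reroot (hd : 1 ≤ d) (p : unitInterval) (hp : 0 < (p : ℝ))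
    (hθ : theta (zdGraph d) 0 p = 0) {s L : ℕ} (hs : 2 ≤ s) {ϰ : ℝ} (hϰ : 0 < ϰ) (hA2 : SetToSetQuasiMultAspectAt d p s L ϰ)
    {ν : Measure (BondConfig (Site d))} [IsProbabilityMeasure ν]
    (hν : ∀ (F : Finset (Sym2 (Site d))) (E : Set (BondConfig (Site d))), MeasurableSet E → DeterminedBy E ↑F →
      Tendsto (fun n : ℕ => (bondPercolation (zdGraph d) p).real (E ∩ siteToBoundary d n) / oneArmProb d p n)
        atTop (𝓝 (ν.real E)))
    (v : Site d) (S : Finset (Site d)) :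
    ν.real ((openConn (0 : Site d) v : Set (BondConfig (Site d))) ∩ ⋂ z ∈ S, (openConn (0 : Site d) z : Set (BondConfig (Site d)))) =
      ν.real ((openConn (0 : Site d) (-v) : Set (BondConfig (Site d))) ∩
        ⋂ z ∈ S, (openConn (0 : Site d) (z - v) : Set (BondConfig (Site d)))) := by
  have hE : MeasurableSet (⋂ z ∈ S, (openConn (0 : Site d) z : Set (BondConfig (Site d)))) :=
    Finset.measurableSet_biInter S fun z _ => measurableSet_openConn_holds 0 z
  have h := iicMeasure_real_inter_openConn_eq_real_preimage_shift hd p hp hθ hs hϰ hA2 hν v hE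
  rw [Set.inter_comm, h, Set.preimage_iInter₂]
  simp_rw [preimage_relabel_shift_openConn_zero_left]
  rw [Set.inter_comm]
  congr 1
  ext ω
  simp only [Set.mem_inter_iff, Set.mem_iInter₂]
  constructor
  · rintro ⟨h0v, hall⟩
    exact ⟨h0v, fun z hz => SimpleGraph.Reachable.trans h0v (hall z hz)⟩
  · rintro ⟨h0v, hall⟩
    exact ⟨h0v, fun z hz => SimpleGraph.Reachable.trans h0v.symm (hall z hz)⟩

/-! ## §2 The spanning-tree lower bound, for every spanning tree -/

open Classical in
/-- **THE k-POINT FUNCTION OF KESTEN'S IIC IS AT LEAST `c^k ∏ π(edge lengths)` FOR EVERY SPANNING TREE** (`p_c(ℤ^d)`, `d ≥ 2`; (A2)□ at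
aspect `(s,L)`, `2 ≤ s ≤ L`, `ϰ > 0`; `CU⁺_l(c_U)`, `l ≥ 2`, `c_U > 0`; `θ(p_c) = 0` via p205010 for the re-rooting; NO annulus decay, NO
separation): there is `c > 0` such that for every IIC probability measure `ν`, every `k`, all sites `z_0 = 0, z_1, …, z_k` and every parent
function `p(i) < i` (`1 ≤ i ≤ k`) with `z_i ≠ z_{p(i)}` (i.e. `‖z_i − z_{p(i)}‖_∞ ≥ 1`):
**`c^k · ∏_{i=1}^{k} π_{p_c}(‖z_i − z_{p(i)}‖_∞) ≤ ν(⋂_{i=1}^{k} {0 ↔ z_i})`**.  Every spanning tree of `{0, z_1, …, z_k}` arises this way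
(list the sites along the tree from the root); the sharpest bound is given by the minimal spanning tree, since `π_{p_c}` is non-increasing:
`ν(S ⊆ C(0)) ≥ c^{|S|} ∏_{e ∈ MST({0} ∪ S)} π_{p_c}(|e|)` for every finite `S`. [cite: Kesten1986, Thm. (8)]
[cite: BasuSapozhnikov2017ECP, Thm. 1.1 and Remark 2.1] -/
theorem exists_iicMeasure_real_biInter_openConn_ge_pow_mul_prod_tree_criticalProbI (hd : 2 ≤ d) {s L : ℕ} (hs : 2 ≤ s)
    (hsL : s ≤ L) {ϰ : ℝ} (hϰ : 0 < ϰ) (hA2 : SetToSetQuasiMultAspectAt d (criticalProbI d) s L ϰ) {l : ℕ} (hl : 2 ≤ l)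
    {cU : ℝ} (hcU : 0 < cU)
    (hCU : ∀ a : ℕ, 1 ≤ a → ∀ E : Set (BondConfig (Site d)), IsUpperSet E → MeasurableSet E →
      cU * (bondPercolation (zdGraph d) (criticalProbI d)).real E ≤ (bondPercolation (zdGraph d) (criticalProbI d)).real (E ∩
        {ω : BondConfig (Site d) | ∀ t ∈ innerBoundary (zdGraph d) (box d a), ∀ s ∈ innerBoundary (zdGraph d) (box d (l * a)),
          ∀ t' ∈ innerBoundary (zdGraph d) (box d a), ∀ s' ∈ innerBoundary (zdGraph d) (box d (l * a)),
          ω ∈ openConnIn (↑((box d (l * a) \ box d a) ∪ innerBoundary (zdGraph d) (box d a)) : Set (Site d)) t s →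
          ω ∈ openConnIn (↑((box d (l * a) \ box d a) ∪ innerBoundary (zdGraph d) (box d a)) : Set (Site d)) t' s' →
          ω ∈ openConnIn (↑((box d (l * a) \ box d a) ∪ innerBoundary (zdGraph d) (box d a)) : Set (Site d)) s s'})) :
    ∃ c : ℝ, 0 < c ∧ ∀ (ν : Measure (BondConfig (Site d))) [IsProbabilityMeasure ν],
      (∀ (F : Finset (Sym2 (Site d))) (E : Set (BondConfig (Site d))), MeasurableSet E → DeterminedBy E ↑F →
        Tendsto (fun n : ℕ => (bondPercolation (zdGraph d) (criticalProbI d)).real (E ∩ siteToBoundary d n) /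
          oneArmProb d (criticalProbI d) n) atTop (𝓝 (ν.real E))) →
      ∀ (k : ℕ) (z : ℕ → Site d) (par : ℕ → ℕ), z 0 = 0 → (∀ i, 1 ≤ i → i ≤ k → par i < i) →
        (∀ i, 1 ≤ i → i ≤ k → 1 ≤ Site.supNorm (z i - z (par i))) →
          c ^ k * ∏ i ∈ Finset.Icc 1 k, oneArmProb d (criticalProbI d) (Site.supNorm (z i - z (par i))) ≤
            ν.real (⋂ i ∈ Finset.Icc 1 k, (openConn (0 : Site d) (z i) : Set (BondConfig (Site d)))) := by
  have hd1 : 1 ≤ d := le_trans (by norm_num) hd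
  have hp : 0 < ((criticalProbI d : unitInterval) : ℝ) := by
    rw [coe_criticalProbI]; exact criticalProb_zd_pos d hd1
  have hπ : ∀ m : ℕ, 0 < oneArmProb d (criticalProbI d) m := fun m => oneArmProb_pos hd1 _ hp m
  have hθ : theta (zdGraph d) 0 (criticalProbI d) = 0 := CSH.percolationContinuity_allDimensions d hd
  obtain ⟨c, hc, h9⟩ := exists_iicMeasure_real_openConn_inter_biInter_ge_mul_criticalProbI' hd hs hsL hϰ hA2 hl hcU hCU
  refine ⟨c, hc, fun ν _ hν k => ?_⟩
  -- re-rooting an indexed configuration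
  have hreroot : ∀ (v : Site d) (T : Finset ℕ) (w : ℕ → Site d),
      ν.real ((openConn (0 : Site d) v : Set (BondConfig (Site d))) ∩ ⋂ i ∈ T, (openConn (0 : Site d) (w i) : Set (BondConfig (Site d)))) =
        ν.real ((openConn (0 : Site d) (-v) : Set (BondConfig (Site d))) ∩
          ⋂ i ∈ T, (openConn (0 : Site d) (w i - v) : Set (BondConfig (Site d)))) := by
    intro v T w
    have e1 : (⋂ x ∈ T.image w, (openConn (0 : Site d) x : Set (BondConfig (Site d)))) =
        ⋂ i ∈ T, (openConn (0 : Site d) (w i) : Set (BondConfig (Site d))) := Finset.set_biInter_finset_image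
    have e2 : (⋂ x ∈ T.image w, (openConn (0 : Site d) (x - v) : Set (BondConfig (Site d)))) =
        ⋂ i ∈ T, (openConn (0 : Site d) (w i - v) : Set (BondConfig (Site d))) := Finset.set_biInter_finset_image
    have h := iicMeasure_real_openConn_inter_biInter_finset_eq_reroot hd1 _ hp hθ hs hϰ hA2 hν v (T.image w)
    rw [e1, e2] at h
    exact h
  induction k with
  | zero =>
    intro z par _ _ _
    have h0 : Finset.Icc 1 0 = ∅ := by rfl
    have hempty : (⋂ i ∈ (∅ : Finset ℕ), (openConn (0 : Site d) (z i) : Set (BondConfig (Site d)))) = Set.univ := by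
      ext ω; simp
    rw [h0, Finset.prod_empty, hempty, probReal_univ, pow_zero, one_mul]
  | succ k ih =>
    intro z par hz0 hpar hfar0
    -- the configuration up to `k`
    have ihk := ih z par hz0 (fun i h1 h2 => hpar i h1 (by omega)) (fun i h1 h2 => hfar0 i h1 (by omega))
    have hIcc : Finset.Icc 1 (k + 1) = insert (k + 1) (Finset.Icc 1 k) := by
      ext i; simp only [Finset.mem_Icc, Finset.mem_insert]; omega
    have hnot : k + 1 ∉ Finset.Icc 1 k := by simp
    rw [hIcc, Finset.prod_insert hnot, Finset.set_biInter_insert]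
    -- the new edge
    have hpk : par (k + 1) < k + 1 := hpar (k + 1) (by omega) le_rfl
    have hr : 1 ≤ Site.supNorm (z (k + 1) - z (par (k + 1))) := hfar0 (k + 1) (by omega) le_rfl
    have hπr := hπ (Site.supNorm (z (k + 1) - z (par (k + 1))))
    by_cases hp0 : par (k + 1) = 0
    · -- the parent is the root: attach `z (k+1)` directly
      have hr0 : Site.supNorm (z (k + 1) - z (par (k + 1))) = Site.supNorm (z (k + 1)) := by rw [hp0, hz0, sub_zero]
      have h := h9 ν hν (z (k + 1)) ((Finset.Icc 1 k).image z) (by rwa [hr0] at hr)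
      rw [Finset.set_biInter_finset_image] at h
      rw [hr0]
      calc c ^ (k + 1) * (oneArmProb d (criticalProbI d) (Site.supNorm (z (k + 1))) *
            ∏ i ∈ Finset.Icc 1 k, oneArmProb d (criticalProbI d) (Site.supNorm (z i - z (par i))))
          = c * oneArmProb d (criticalProbI d) (Site.supNorm (z (k + 1))) *
            (c ^ k * ∏ i ∈ Finset.Icc 1 k, oneArmProb d (criticalProbI d) (Site.supNorm (z i - z (par i)))) := by ring
        _ ≤ c * oneArmProb d (criticalProbI d) (Site.supNorm (z (k + 1))) *
            ν.real (⋂ i ∈ Finset.Icc 1 k, (openConn (0 : Site d) (z i) : Set (BondConfig (Site d)))) :=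
          mul_le_mul_of_nonneg_left ihk (mul_nonneg hc.le (hπ _).le)
        _ ≤ _ := h
    · -- the parent is a site `v = z p`, `1 ≤ p ≤ k`: re-root at `v`
      have hpmem : par (k + 1) ∈ Finset.Icc 1 k := by rw [Finset.mem_Icc]; omega
      -- `V_k = {0 ↔ v} ∩ W`
      have hVk : (⋂ i ∈ Finset.Icc 1 k, (openConn (0 : Site d) (z i) : Set (BondConfig (Site d)))) =
          (openConn (0 : Site d) (z (par (k + 1))) : Set (BondConfig (Site d))) ∩
            ⋂ i ∈ (Finset.Icc 1 k).erase (par (k + 1)), (openConn (0 : Site d) (z i) : Set (BondConfig (Site d))) := by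
        rw [← Finset.insert_erase hpmem, Finset.set_biInter_insert, Finset.insert_erase hpmem]
      -- the target event as `{0 ↔ v} ∩ ⋂_{i ∈ T} {0 ↔ z i}`, `T = insert (k+1) (erase p)`
      have hT : (openConn (0 : Site d) (z (k + 1)) : Set (BondConfig (Site d))) ∩
          ⋂ i ∈ Finset.Icc 1 k, (openConn (0 : Site d) (z i) : Set (BondConfig (Site d))) =
          (openConn (0 : Site d) (z (par (k + 1))) : Set (BondConfig (Site d))) ∩
            ⋂ i ∈ insert (k + 1) ((Finset.Icc 1 k).erase (par (k + 1))), (openConn (0 : Site d) (z i) : Set (BondConfig (Site d))) := by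
        rw [hVk, Finset.set_biInter_insert, Set.inter_left_comm]
      rw [hT, hreroot (z (par (k + 1))) (insert (k + 1) ((Finset.Icc 1 k).erase (par (k + 1)))) z]
      -- after re-rooting: `{0 ↔ z(k+1) − v} ∩ ({0 ↔ −v} ∩ ⋂_{erase} {0 ↔ z i − v})`
      rw [Finset.set_biInter_insert, Set.inter_left_comm]
      have h := h9 ν hν (z (k + 1) - z (par (k + 1)))
        (insert (-z (par (k + 1))) (((Finset.Icc 1 k).erase (par (k + 1))).image fun i => z i - z (par (k + 1)))) hr
      rw [Finset.set_biInter_insert, Finset.set_biInter_finset_image] at h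
      -- re-root back: `ν({0 ↔ −v} ∩ ⋂_{erase} {0 ↔ z i − v}) = ν({0 ↔ v} ∩ ⋂_{erase} {0 ↔ z i}) = ν(V_k)`
      have hback : ν.real ((openConn (0 : Site d) (-z (par (k + 1))) : Set (BondConfig (Site d))) ∩
          ⋂ i ∈ (Finset.Icc 1 k).erase (par (k + 1)), (openConn (0 : Site d) (z i - z (par (k + 1))) : Set (BondConfig (Site d)))) =
          ν.real (⋂ i ∈ Finset.Icc 1 k, (openConn (0 : Site d) (z i) : Set (BondConfig (Site d)))) := by
        rw [hVk]; exact (hreroot (z (par (k + 1))) ((Finset.Icc 1 k).erase (par (k + 1))) z).symm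
      rw [hback] at h
      calc c ^ (k + 1) * (oneArmProb d (criticalProbI d) (Site.supNorm (z (k + 1) - z (par (k + 1)))) *
            ∏ i ∈ Finset.Icc 1 k, oneArmProb d (criticalProbI d) (Site.supNorm (z i - z (par i))))
          = c * oneArmProb d (criticalProbI d) (Site.supNorm (z (k + 1) - z (par (k + 1)))) *
            (c ^ k * ∏ i ∈ Finset.Icc 1 k, oneArmProb d (criticalProbI d) (Site.supNorm (z i - z (par i)))) := by ring
        _ ≤ c * oneArmProb d (criticalProbI d) (Site.supNorm (z (k + 1) - z (par (k + 1)))) *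
            ν.real (⋂ i ∈ Finset.Icc 1 k, (openConn (0 : Site d) (z i) : Set (BondConfig (Site d)))) :=
          mul_le_mul_of_nonneg_left ihk (mul_nonneg hc.le hπr.le)
        _ ≤ _ := h

end Summit.CriticalPhenomena.PercolationContinuityZ3.Theorems.Crossing

end
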